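import Literature.NumberTheory.LFunctions.TruncatedWeilFormTailOrder
import Literature.NumberTheory.LFunctions.RiemannSiegelStirling
import HarnessLib

/-!
# RH-FREE — «nothing here bears on the truth of RH»: the archimedean density `h₊` (Groskin 2026, arXiv:2607.02828, Lemma 3.1: proof of the claim `lemma_3_1`)

PROOF LAYER (theorems only, 0 defs / 0 named facts) for
`Literature/NumberTheory/LFunctions/TruncatedWeilFormTailOrder.lean` (statement file of cell
`rh-columns/lit`; this file written by seat rh-crit-cc-t6, bears_on LADDER-RH W-C/W-P = COLUMN 2 WEIL).
It DISCHARGES the claim `Groskin2026.lemma_3_1` (A. Groskin, *A finite Guinand–Weil dictionary and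
archimedean tail order for the truncated Weil quadratic form*, arXiv:2607.02828v3, Lemma 3.1, p. 9) about
`h₊(t) = Re ψ(¼ + it/2) − log π`:

1. `h₊` is strictly increasing on `(0, ∞)`;
2. for `t > 0`, `h₊′(t) = (t/2) Σ_{k ≥ 0} (k + ¼)/((k + ¼)² + (t/2)²)²` and this is `≤ 1/t + 13/(10t²)`;
3. `h₊(t) ≤ log t − 8/5` for `t ≥ 7`.

## Route

Everything rests on the tree's vertical series `Re ψ(¼ + it/2) − ψ(¼) = Σ_m 2t²/(l_m(l_m² + t²))`,
`l_m = 2m + ½` (`Literature.Analysis.SpecialFunctions.hasSum_digammaTerm`, Andrews–Askey–Roy (1.2.13)):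
(1) each term is strictly increasing in `t ≥ 0`, so the sum is (`Summable.tsum_lt_tsum`);
(2) termwise differentiation (`hasDerivAt_tsum`; `|d/dt 2t²/(l(l²+t²))| = 4|t|l/(l²+t²)² ≤ 2/l²`,
summable), and `4tl_k/(l_k² + t²)² = (t/2)(k + ¼)/((k + ¼)² + (t/2)²)²`; the bound is the comparison
`Σ_{k≥0} f(k) ≤ ∫₀^∞ f + sup f` for the unimodal `f(u) = (u + ¼)/((u + ¼)² + s²)²`, `s = t/2`
(increasing for `(u+¼)² ≤ s²/3`, decreasing after), with `∫₀^∞ f = 1/(2(1/16 + s²)) ≤ 2/t²` and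
`sup f = 1/(16y³)`, `y = s/√3` (AM–GM: `(A² + 3y²)² − 16y³A = (A − y)²(A² + 2Ay + 9y²)`), giving
`(t/2)Σ ≤ 1/t + 3√3/(4t²) ≤ 1/t + 13/(10t²)` (`3√3/4 = 1.29904 < 13/10`; the printed constant is this
tight);
(3) the tree's second-order Stirling bound `|Re ψ(w) − log‖w‖ + Re(1/(2w))| ≤ 1/(6|Im w|³) + π/(12(Im w)²)`
(`Literature.NumberTheory.LFunctions.Complex.abs_re_digamma_sub_log_norm_add_re_le`) at
`w = ¼ + it/2`, `t ≥ 7`, with `‖w‖² ≤ (197/784)t²`, `log 2 > 0.6931`, `π < 3.15` and `log π > 1`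
(`π > 3 > e`): `h₊(t) ≤ log t − 0.665 − log π ≤ log t − 8/5`.

The source is an unrefereed preprint ([claim: Groskin2026, status: under-review]); a kernel proof of
these calculus facts asserts nothing on its authority. Nothing here bears on Weil positivity or RH.
-/

noncomputable section

open Filter Set MeasureTheory Finset Complex
open scoped Real Topology

namespace Literature.NumberTheory.LFunctions

namespace Groskin2026

open Literature.Analysis.SpecialFunctions

/-! ### §1 The series form of `h₊` -/

/-- `h₊(t) = h₊(0) + Σ_m 2t²/(l_m(l_m² + t²))` (the tree's vertical series `hasSum_digammaTerm`).
[cite: Groskin2026, Lemma 3.1 (p. 9); AndrewsAskeyRoy1999, Thm 1.2.5 (1.2.13)] -/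
theorem hPlus_eq_add_tsum (t : ℝ) :
    hPlus t = hPlus 0 + ∑' m : ℕ, digammaTerm (digammaNode m) t := by
  rw [tsum_digammaTerm]
  unfold hPlus
  ring

/-! ### §2 Strict monotonicity on `(0, ∞)` -/

/-- Each term `2t²/(l(l² + t²))` is strictly increasing in `t ≥ 0` (`l > 0`). [folklore] -/
private theorem digammaTerm_lt {l u t : ℝ} (hl : 0 < l) (hu : 0 ≤ u) (hut : u < t) :
    digammaTerm l u < digammaTerm l t := by
  unfold digammaTerm
  have ht : 0 < t := lt_of_le_of_lt hu hut
  have h1 : 0 < l * (l ^ 2 + u ^ 2) := by positivity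
  have h2 : 0 < l * (l ^ 2 + t ^ 2) := by positivity
  rw [div_lt_div_iff₀ h1 h2]
  have hut2 : u ^ 2 < t ^ 2 := by nlinarith
  nlinarith [mul_pos hl (mul_pos hl hl)]

/-- **[Gr26] Lemma 3.1, first clause, PROVED**: `h₊` is strictly increasing on `(0, ∞)`.
[cite: Groskin2026, Lemma 3.1 (p. 9)] -/
theorem hPlus_strictMonoOn : StrictMonoOn hPlus (Set.Ioi 0) := by
  intro u hu t _ hut
  rw [hPlus_eq_add_tsum u, hPlus_eq_add_tsum t]
  have hlt : ∑' m : ℕ, digammaTerm (digammaNode m) u < ∑' m : ℕ, digammaTerm (digammaNode m) t :=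
    Summable.tsum_lt_tsum (i := 0)
      (fun m ↦ (digammaTerm_lt (digammaNode_pos m) (le_of_lt hu) hut).le)
      (digammaTerm_lt (digammaNode_pos 0) (le_of_lt hu) hut)
      (summable_digammaTerm u) (summable_digammaTerm t)
  linarith

/-! ### §3 Termwise differentiation -/

/-- `d/dt [2t²/(l(l² + t²))] = 4tl/(l² + t²)²` (`l > 0`). [folklore] -/
private theorem hasDerivAt_digammaTerm {l : ℝ} (hl : 0 < l) (t : ℝ) :
    HasDerivAt (fun t : ℝ ↦ digammaTerm l t) (4 * t * l / (l ^ 2 + t ^ 2) ^ 2) t := by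
  unfold digammaTerm
  have hD : l * (l ^ 2 + t ^ 2) ≠ 0 := by positivity
  have hnum : HasDerivAt (fun t : ℝ ↦ 2 * t ^ 2) (2 * (2 * t)) t := by
    simpa using (hasDerivAt_pow 2 t).const_mul 2
  have hden : HasDerivAt (fun t : ℝ ↦ l * (l ^ 2 + t ^ 2)) (l * (2 * t)) t := by
    have h1 : HasDerivAt (fun t : ℝ ↦ l ^ 2 + t ^ 2) (2 * t) t := by
      simpa using (hasDerivAt_pow 2 t).const_add (l ^ 2)
    simpa using h1.const_mul l
  have key : HasDerivAt (fun t : ℝ ↦ 2 * t ^ 2 / (l * (l ^ 2 + t ^ 2))) _ t := hnum.div hden hD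
  refine key.congr_deriv ?_
  have hl2 : (l ^ 2 + t ^ 2) ≠ 0 := by positivity
  field_simp
  ring

/-- The termwise derivative is dominated by the summable `2/l²`: `|4tl/(l² + t²)²| ≤ 2/l²`. [folklore] -/
private theorem abs_deriv_digammaTerm_le {l : ℝ} (hl : 0 < l) (t : ℝ) :
    ‖4 * t * l / (l ^ 2 + t ^ 2) ^ 2‖ ≤ 2 / l ^ 2 := by
  rw [Real.norm_eq_abs, abs_div, abs_of_pos (by positivity : (0 : ℝ) < (l ^ 2 + t ^ 2) ^ 2)]
  rw [show |4 * t * l| = 4 * |t| * l by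
    rw [abs_mul, abs_mul, abs_of_pos hl, abs_of_pos (by norm_num : (0:ℝ) < 4)]]
  rw [div_le_div_iff₀ (by positivity) (by positivity)]
  have ha : 0 ≤ |t| := abs_nonneg t
  have ht2 : t ^ 2 = |t| ^ 2 := (sq_abs t).symm
  rw [ht2]
  nlinarith [sq_nonneg (l - |t|), mul_nonneg ha hl.le, sq_nonneg (l * |t|), sq_nonneg (|t| ^ 2),
    mul_nonneg (mul_nonneg ha hl.le) (sq_nonneg (l - |t|)), pow_pos hl 3, pow_pos hl 4,
    mul_nonneg (pow_nonneg ha 3) hl.le]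

/-- `Σ_m 2/l_m²` converges. [folklore] -/
private theorem summable_two_div_digammaNode_sq : Summable fun m : ℕ ↦ 2 / digammaNode m ^ 2 := by
  have hs : Summable fun m : ℕ ↦ (8 : ℝ) * (1 / ((m : ℝ) + 1) ^ 2) := by
    have h := (summable_nat_add_iff 1).mpr (Real.summable_one_div_nat_pow.mpr one_lt_two)
    refine (h.congr fun m ↦ ?_).mul_left 8
    push_cast
    ring
  refine Summable.of_nonneg_of_le (fun m ↦ by have := digammaNode_pos m; positivity) (fun m ↦ ?_) hs
  unfold digammaNode
  have hm : (0 : ℝ) ≤ m := Nat.cast_nonneg m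
  rw [div_le_iff₀ (by positivity)]
  have h1 : (0 : ℝ) < ((m : ℝ) + 1) ^ 2 := by positivity
  have : 8 * (1 / ((m : ℝ) + 1) ^ 2) * (2 * m + 1 / 2) ^ 2 = 8 * (2 * m + 1 / 2) ^ 2 / ((m : ℝ) + 1) ^ 2 := by
    ring
  rw [this, le_div_iff₀ h1]
  nlinarith

/-- Termwise differentiation of the vertical series: for every real `t`,
`h₊′(t) = Σ_m 4tl_m/(l_m² + t²)²`. [cite: Groskin2026, Lemma 3.1 (p. 9)] -/
theorem hasDerivAt_hPlus_series (t : ℝ) :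
    HasDerivAt hPlus (∑' m : ℕ, 4 * t * digammaNode m / (digammaNode m ^ 2 + t ^ 2) ^ 2) t := by
  have hfun : hPlus = fun z : ℝ ↦ hPlus 0 + ∑' m : ℕ, digammaTerm (digammaNode m) z :=
    funext hPlus_eq_add_tsum
  have hser : HasDerivAt (fun z : ℝ ↦ ∑' m : ℕ, digammaTerm (digammaNode m) z)
      (∑' m : ℕ, 4 * t * digammaNode m / (digammaNode m ^ 2 + t ^ 2) ^ 2) t := by
    refine hasDerivAt_tsum (y₀ := 0) summable_two_div_digammaNode_sq
      (fun m y ↦ hasDerivAt_digammaTerm (digammaNode_pos m) y)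
      (fun m y ↦ abs_deriv_digammaTerm_le (digammaNode_pos m) y) ?_ t
    simp [digammaTerm_zero]
  rw [hfun]
  exact hser.const_add _

/-- The termwise derivative in the printed normalisation:
`4tl_k/(l_k² + t²)² = (t/2)(k + ¼)/((k + ¼)² + (t/2)²)²`, `l_k = 2k + ½ = 2(k + ¼)`. [cite: Groskin2026, Lemma 3.1 (p. 9)] -/
theorem deriv_term_eq (t : ℝ) (k : ℕ) :
    4 * t * digammaNode k / (digammaNode k ^ 2 + t ^ 2) ^ 2 =
      t / 2 * (((k : ℝ) + 1 / 4) / (((k : ℝ) + 1 / 4) ^ 2 + (t / 2) ^ 2) ^ 2) := by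
  unfold digammaNode
  have h1 : (((k : ℝ) + 1 / 4) ^ 2 + (t / 2) ^ 2) ≠ 0 := by positivity
  have h2 : ((2 * (k : ℝ) + 1 / 2) ^ 2 + t ^ 2) ≠ 0 := by positivity
  field_simp
  ring

/-- **[Gr26] Lemma 3.1, derivative formula, PROVED**: for every real `t`,
`h₊′(t) = (t/2) Σ_{k≥0} (k + ¼)/((k + ¼)² + (t/2)²)²`. [cite: Groskin2026, Lemma 3.1 (p. 9)] -/
theorem hasDerivAt_hPlus (t : ℝ) :
    HasDerivAt hPlus
      (t / 2 * ∑' k : ℕ, ((k : ℝ) + 1 / 4) / (((k : ℝ) + 1 / 4) ^ 2 + (t / 2) ^ 2) ^ 2) t := by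
  have h := hasDerivAt_hPlus_series t
  simp_rw [deriv_term_eq] at h
  rwa [tsum_mul_left] at h

/-! ### §4 The bound `h₊′(t) ≤ 1/t + 13/(10t²)` -/

/-- **Sum versus integral for a unimodal function.** If `f ≥ 0` is continuous, increasing on `[0, a]`,
decreasing on `[a, ∞)`, bounded by `M` and with `∫₀^R f ≤ J` for all `R ≥ 0`, then every partial sum
`Σ_{i<n} f(i) ≤ J + M` (the terms left of `⌊a⌋` are bounded by the integral over the cell to their
right, those right of `⌊a⌋ + 1` by the cell to their left, and the two middle terms by `M` plus the
middle cell). [folklore] -/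
private theorem sum_le_of_unimodal {f : ℝ → ℝ} {a M J : ℝ} (ha : 0 ≤ a)
    (hf : Continuous f) (h0 : ∀ u, 0 ≤ u → 0 ≤ f u)
    (hmono : MonotoneOn f (Icc 0 a)) (hanti : AntitoneOn f (Ici a))
    (hM : ∀ u, 0 ≤ u → f u ≤ M) (hJ : ∀ R, 0 ≤ R → ∫ u in (0:ℝ)..R, f u ≤ J) (n : ℕ) :
    ∑ i ∈ Finset.range n, f i ≤ J + M := by
  set K : ℕ := ⌊a⌋₊ with hK
  have hKa : (K : ℝ) ≤ a := Nat.floor_le ha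
  have haK : a < (K : ℝ) + 1 := Nat.lt_floor_add_one a
  -- enlarge n to K + 2 + r
  obtain ⟨r, hr⟩ : ∃ r : ℕ, n ≤ K + 2 + r := ⟨n, by omega⟩
  have hmono_n : ∑ i ∈ Finset.range n, f i ≤ ∑ i ∈ Finset.range (K + 2 + r), f i :=
    Finset.sum_le_sum_of_subset_of_nonneg (Finset.range_mono hr)
      (fun i _ _ ↦ h0 i (Nat.cast_nonneg i))
  refine hmono_n.trans ?_
  rw [Finset.sum_range_add, Finset.sum_range_succ, Finset.sum_range_succ]
  -- (i) increasing part
  have h1 : ∑ i ∈ Finset.range K, f i ≤ ∫ u in (0:ℝ)..K, f u := by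
    have hm : MonotoneOn f (Icc (0:ℝ) ((0:ℝ) + K)) := hmono.mono (by
      rw [zero_add]; exact Icc_subset_Icc le_rfl hKa)
    have := hm.sum_le_integral
    simpa using this
  -- (ii) decreasing part
  have h2 : ∑ j ∈ Finset.range r, f (↑(K + 2 + j)) ≤ ∫ u in ((K:ℝ) + 1)..((K:ℝ) + 1 + r), f u := by
    have hm : AntitoneOn f (Icc ((K:ℝ) + 1) ((K:ℝ) + 1 + r)) := hanti.mono (fun u hu ↦ by
      simp only [Set.mem_Icc] at hu; simp only [Set.mem_Ici]; linarith [hu.1])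
    have := hm.sum_le_integral
    refine le_trans (le_of_eq (Finset.sum_congr rfl fun j _ ↦ ?_)) this
    congr 1; push_cast; ring
  -- (iii) the two middle terms
  have h3 : f K + f (↑(K + 1)) ≤ M + ∫ u in (K:ℝ)..((K:ℝ) + 1), f u := by
    have hmin : min (f K) (f ((K:ℝ) + 1)) ≤ ∫ u in (K:ℝ)..((K:ℝ) + 1), f u := by
      have hc : ∫ u in (K:ℝ)..((K:ℝ) + 1), min (f K) (f ((K:ℝ) + 1)) = min (f K) (f ((K:ℝ) + 1)) := by
        simp
      rw [← hc]
      apply intervalIntegral.integral_mono_on (by linarith)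
        (by simp) (hf.intervalIntegrable _ _)
      intro u hu
      rcases le_or_gt u a with hua | hua
      · exact (min_le_left _ _).trans (hmono ⟨(Nat.cast_nonneg K), hKa⟩ ⟨by linarith [hu.1, (Nat.cast_nonneg K : (0:ℝ) ≤ K)], hua⟩ hu.1)
      · exact (min_le_right _ _).trans
          (hanti (show u ∈ Ici a from hua.le) (show (K:ℝ) + 1 ∈ Ici a from haK.le) hu.2)
    have hmax : max (f K) (f ((K:ℝ) + 1)) ≤ M :=
      max_le (hM _ (Nat.cast_nonneg K)) (hM _ (by positivity))
    have := min_add_max (f K) (f ((K:ℝ) + 1))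
    push_cast
    linarith
  -- (iv) add up the integrals
  have hint : ∀ a b : ℝ, IntervalIntegrable f volume a b := fun a b ↦ hf.intervalIntegrable a b
  have hadd : (∫ u in (0:ℝ)..K, f u) + (∫ u in (K:ℝ)..((K:ℝ) + 1), f u) +
      (∫ u in ((K:ℝ) + 1)..((K:ℝ) + 1 + r), f u) = ∫ u in (0:ℝ)..((K:ℝ) + 1 + r), f u := by
    rw [intervalIntegral.integral_add_adjacent_intervals (hint _ _) (hint _ _),
      intervalIntegral.integral_add_adjacent_intervals (hint _ _) (hint _ _)]
  have hJ' := hJ ((K:ℝ) + 1 + r) (by positivity)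
  linarith

variable {s : ℝ}

/-- `d/du [(u+¼)/((u+¼)² + s²)²] = (s² − 3(u+¼)²)/((u+¼)² + s²)³`. [folklore] -/
private theorem hasDerivAt_bump (hs : 0 < s) (u : ℝ) :
    HasDerivAt (fun u : ℝ ↦ (u + 1 / 4) / ((u + 1 / 4) ^ 2 + s ^ 2) ^ 2)
      ((s ^ 2 - 3 * (u + 1 / 4) ^ 2) / ((u + 1 / 4) ^ 2 + s ^ 2) ^ 3) u := by
  have hD : ((u + 1 / 4) ^ 2 + s ^ 2) ^ 2 ≠ 0 := by positivity
  have hnum : HasDerivAt (fun u : ℝ ↦ u + 1 / 4) 1 u := by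
    simpa using (hasDerivAt_id u).add_const (1 / 4 : ℝ)
  have h1 : HasDerivAt (fun u : ℝ ↦ (u + 1 / 4) ^ 2 + s ^ 2) (((2 : ℕ) : ℝ) * (u + 1 / 4) ^ (2 - 1) * 1) u :=
    (hnum.pow 2).add_const (s ^ 2)
  have hden : HasDerivAt (fun u : ℝ ↦ ((u + 1 / 4) ^ 2 + s ^ 2) ^ 2)
      (((2 : ℕ) : ℝ) * ((u + 1 / 4) ^ 2 + s ^ 2) ^ (2 - 1) * (((2 : ℕ) : ℝ) * (u + 1 / 4) ^ (2 - 1) * 1)) u :=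
    h1.pow 2
  have key := hnum.div hden hD
  refine key.congr_deriv ?_
  have hD1 : ((u + 1 / 4) ^ 2 + s ^ 2) ≠ 0 := by positivity
  field_simp
  ring

/-- Continuity of `u ↦ (u+¼)/((u+¼)² + s²)²` (`s > 0`). [folklore] -/
private theorem continuous_bump (hs : 0 < s) :
    Continuous (fun u : ℝ ↦ (u + 1 / 4) / ((u + 1 / 4) ^ 2 + s ^ 2) ^ 2) := by
  apply Continuous.div (by fun_prop) (by fun_prop)
  intro u; positivity

/-- Nonnegativity of `(u+¼)/((u+¼)² + s²)²` for `u ≥ 0`. [folklore] -/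
private theorem bump_nonneg (_hs : 0 < s) {u : ℝ} (hu : 0 ≤ u) :
    0 ≤ (u + 1 / 4) / ((u + 1 / 4) ^ 2 + s ^ 2) ^ 2 := by positivity

/-- `(u+¼)/((u+¼)² + s²)²` increases while `u + ¼ ≤ y = s/√3`. [folklore] -/
private theorem bump_monotoneOn (hs : 0 < s) {y : ℝ} (hy : 0 < y) (hsy : s ^ 2 = 3 * y ^ 2) :
    MonotoneOn (fun u : ℝ ↦ (u + 1 / 4) / ((u + 1 / 4) ^ 2 + s ^ 2) ^ 2) (Icc 0 (max (y - 1 / 4) 0)) := by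
  apply monotoneOn_of_deriv_nonneg (convex_Icc _ _) (continuous_bump hs).continuousOn
  · intro u _; exact (hasDerivAt_bump hs u).differentiableAt.differentiableWithinAt
  · intro u hu
    rw [interior_Icc, Set.mem_Ioo] at hu
    rw [(hasDerivAt_bump hs u).deriv]
    apply div_nonneg _ (by positivity)
    have hu2 : u < y - 1 / 4 := by
      rcases le_or_gt (y - 1 / 4) 0 with h | h
      · rw [max_eq_right h] at hu; linarith [hu.1, hu.2]
      · rw [max_eq_left h.le] at hu; exact hu.2
    have hA : 0 ≤ u + 1 / 4 := by linarith [hu.1]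
    have hAy : u + 1 / 4 ≤ y := by linarith
    nlinarith [mul_le_mul hAy hAy hA hy.le]

/-- `(u+¼)/((u+¼)² + s²)²` decreases once `u + ¼ ≥ y = s/√3`. [folklore] -/
private theorem bump_antitoneOn (hs : 0 < s) {y : ℝ} (hy : 0 < y) (hsy : s ^ 2 = 3 * y ^ 2) :
    AntitoneOn (fun u : ℝ ↦ (u + 1 / 4) / ((u + 1 / 4) ^ 2 + s ^ 2) ^ 2) (Ici (max (y - 1 / 4) 0)) := by
  apply antitoneOn_of_deriv_nonpos (convex_Ici _) (continuous_bump hs).continuousOn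
  · intro u _; exact (hasDerivAt_bump hs u).differentiableAt.differentiableWithinAt
  · intro u hu
    rw [interior_Ici, Set.mem_Ioi, max_lt_iff] at hu
    rw [(hasDerivAt_bump hs u).deriv]
    apply div_nonpos_of_nonpos_of_nonneg _ (by positivity)
    have hAy : y < u + 1 / 4 := by linarith [hu.1]
    nlinarith [mul_lt_mul'' hAy hAy hy.le hy.le]

/-- The maximum: `(u+¼)/((u+¼)² + 3y²)² ≤ 1/(16y³)` (AM–GM; equality at `u + ¼ = y`), via
`(A² + 3y²)² − 16y³A = (A − y)²(A² + 2Ay + 9y²)`. [folklore] -/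
private theorem bump_le_sup {y : ℝ} (hy : 0 < y) (hsy : s ^ 2 = 3 * y ^ 2) {u : ℝ} (hu : 0 ≤ u) :
    (u + 1 / 4) / ((u + 1 / 4) ^ 2 + s ^ 2) ^ 2 ≤ 1 / (16 * y ^ 3) := by
  rw [hsy, div_le_div_iff₀ (by positivity) (by positivity), one_mul]
  have key : ((u + 1 / 4) ^ 2 + 3 * y ^ 2) ^ 2 - 16 * y ^ 3 * (u + 1 / 4) =
      ((u + 1 / 4) - y) ^ 2 * ((u + 1 / 4) ^ 2 + 2 * (u + 1 / 4) * y + 9 * y ^ 2) := by ring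
  have hpos : 0 ≤ ((u + 1 / 4) - y) ^ 2 * ((u + 1 / 4) ^ 2 + 2 * (u + 1 / 4) * y + 9 * y ^ 2) := by
    positivity
  nlinarith

/-- The integral: `∫₀^R (u+¼)/((u+¼)² + s²)² du = 1/(2(1/16 + s²)) − 1/(2((R+¼)² + s²)) ≤ 1/(2s²)`
(antiderivative `−1/(2((u+¼)² + s²))`). [folklore] -/
private theorem integral_bump_le (hs : 0 < s) {R : ℝ} (hR : 0 ≤ R) :
    ∫ u in (0:ℝ)..R, (u + 1 / 4) / ((u + 1 / 4) ^ 2 + s ^ 2) ^ 2 ≤ 1 / (2 * s ^ 2) := by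
  have hderiv : ∀ u ∈ Set.uIcc (0:ℝ) R,
      HasDerivAt (fun u : ℝ ↦ -1 / (2 * ((u + 1 / 4) ^ 2 + s ^ 2)))
        ((u + 1 / 4) / ((u + 1 / 4) ^ 2 + s ^ 2) ^ 2) u := by
    intro u _
    have hD : 2 * ((u + 1 / 4) ^ 2 + s ^ 2) ≠ 0 := by positivity
    have hnum : HasDerivAt (fun u : ℝ ↦ u + 1 / 4) 1 u := by
      simpa using (hasDerivAt_id u).add_const (1 / 4 : ℝ)
    have h1 : HasDerivAt (fun u : ℝ ↦ 2 * ((u + 1 / 4) ^ 2 + s ^ 2))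
        (2 * (((2 : ℕ) : ℝ) * (u + 1 / 4) ^ (2 - 1) * 1)) u :=
      ((hnum.pow 2).add_const (s ^ 2)).const_mul 2
    have key := (hasDerivAt_const u (-1 : ℝ)).div h1 hD
    refine key.congr_deriv ?_
    have hD1 : ((u + 1 / 4) ^ 2 + s ^ 2) ≠ 0 := by positivity
    field_simp
    ring
  rw [intervalIntegral.integral_eq_sub_of_hasDerivAt hderiv
    ((continuous_bump hs).intervalIntegrable _ _)]
  have h1 : 0 < 2 * ((R + 1 / 4) ^ 2 + s ^ 2) := by positivity
  have h2 : -1 / (2 * (((0:ℝ) + 1 / 4) ^ 2 + s ^ 2)) ≥ -1 / (2 * s ^ 2) := by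
    rw [ge_iff_le, div_le_div_iff₀ (by positivity) (by positivity)]
    nlinarith
  have h3 : -1 / (2 * ((R + 1 / 4) ^ 2 + s ^ 2)) ≤ 0 :=
    div_nonpos_of_nonpos_of_nonneg (by norm_num) h1.le
  calc -1 / (2 * ((R + 1 / 4) ^ 2 + s ^ 2)) - -1 / (2 * (((0:ℝ) + 1 / 4) ^ 2 + s ^ 2))
      ≤ 0 - -1 / (2 * s ^ 2) := sub_le_sub h3 h2
    _ = 1 / (2 * s ^ 2) := by ring

/-- **[Gr26] Lemma 3.1, derivative bound, PROVED**: for `t > 0`,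
`(t/2) Σ_{k≥0} (k+¼)/((k+¼)² + (t/2)²)² ≤ 1/t + 13/(10t²)`. With `s = t/2`, `y = s/√3`: the sum is at most
`∫₀^∞ + sup = 1/(2s²) + 1/(16y³) = 2/t² + 3√3/(2t³)` (unimodal comparison), and
`(t/2)(2/t² + 3√3/(2t³)) = 1/t + (3√3/4)/t² ≤ 1/t + (13/10)/t²` since `√3 ≤ 26/15`.
[cite: Groskin2026, Lemma 3.1 (p. 9)] -/
theorem deriv_hPlus_le {t : ℝ} (ht : 0 < t) :
    t / 2 * ∑' k : ℕ, ((k : ℝ) + 1 / 4) / (((k : ℝ) + 1 / 4) ^ 2 + (t / 2) ^ 2) ^ 2 ≤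
      1 / t + 13 / (10 * t ^ 2) := by
  set s : ℝ := t / 2 with hs_def
  have hs : 0 < s := by positivity
  set r : ℝ := Real.sqrt 3 with hr_def
  have hr : 0 < r := Real.sqrt_pos.2 (by norm_num)
  have hr2 : r ^ 2 = 3 := Real.sq_sqrt (by norm_num)
  set y : ℝ := s / r with hy_def
  have hy : 0 < y := by positivity
  have hyr : y * r = s := by rw [hy_def]; field_simp
  have hsy : s ^ 2 = 3 * y ^ 2 := by
    rw [← hyr, mul_pow, hr2]; ring
  -- partial sums
  have hpart : ∀ n : ℕ, ∑ i ∈ Finset.range n,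
      ((i : ℝ) + 1 / 4) / (((i : ℝ) + 1 / 4) ^ 2 + s ^ 2) ^ 2 ≤ 1 / (2 * s ^ 2) + 1 / (16 * y ^ 3) :=
    fun n ↦ sum_le_of_unimodal (f := fun u : ℝ ↦ (u + 1 / 4) / ((u + 1 / 4) ^ 2 + s ^ 2) ^ 2)
      (le_max_right _ _) (continuous_bump hs) (fun u hu ↦ bump_nonneg hs hu)
      (bump_monotoneOn hs hy hsy) (bump_antitoneOn hs hy hsy) (fun u hu ↦ bump_le_sup hy hsy hu)
      (fun R hR ↦ integral_bump_le hs hR) n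
  have htsum : ∑' k : ℕ, ((k : ℝ) + 1 / 4) / (((k : ℝ) + 1 / 4) ^ 2 + s ^ 2) ^ 2 ≤
      1 / (2 * s ^ 2) + 1 / (16 * y ^ 3) :=
    Real.tsum_le_of_sum_range_le (fun k ↦ bump_nonneg hs (Nat.cast_nonneg k)) hpart
  have hr3 : r ^ 3 = 3 * r := by rw [pow_succ, hr2]
  have hrle : r ≤ 26 / 15 := by nlinarith
  have ht0 : t ≠ 0 := ht.ne'
  calc t / 2 * ∑' k : ℕ, ((k : ℝ) + 1 / 4) / (((k : ℝ) + 1 / 4) ^ 2 + s ^ 2) ^ 2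
      ≤ t / 2 * (1 / (2 * s ^ 2) + 1 / (16 * y ^ 3)) :=
        mul_le_mul_of_nonneg_left htsum (by positivity)
    _ = 1 / t + 3 * r / (4 * t ^ 2) := by
        rw [hy_def, hs_def]
        field_simp
        rw [hr3]
        ring
    _ ≤ 1 / t + 13 / (10 * t ^ 2) := by
        have : 3 * r / (4 * t ^ 2) ≤ 13 / (10 * t ^ 2) := by
          rw [div_le_div_iff₀ (by positivity) (by positivity)]
          nlinarith [sq_nonneg t, pow_pos ht 2]
        linarith

/-! ### §5 The upper bound on `[7, ∞)` -/

/-- **[Gr26] Lemma 3.1, last clause, PROVED**: `h₊(t) ≤ log t − 8/5` for `t ≥ 7` — from the tree's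
second-order Stirling bound `|Re ψ(w) − log ‖w‖ + Re(1/(2w))| ≤ 1/(6|Im w|³) + π/(12 (Im w)²)` at
`w = ¼ + it/2` (`Re(1/(2w)) ≥ 0`), `‖w‖² = 1/16 + t²/4 ≤ (197/784)t²`, `log(197/196) ≤ 1/196`,
`log 2 > 0.6931`, `π < 3.15`, and `log π > 1` (`π > 3 > e`): `h₊(t) ≤ log t − 1.665`.
[cite: Groskin2026, Lemma 3.1 (p. 9)] -/
theorem hPlus_le_log_sub {t : ℝ} (ht : 7 ≤ t) : hPlus t ≤ Real.log t - 8 / 5 := by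
  have ht0 : 0 < t := by linarith
  unfold hPlus reDigammaQuarter
  set w : ℂ := 1 / 4 + (t : ℂ) / 2 * I with hw_def
  have hre : w.re = 1 / 4 := by simp [hw_def]
  have him : w.im = t / 2 := by simp [hw_def]
  have hw : 0 < w.re := by rw [hre]; norm_num
  have hy : w.im ≠ 0 := by rw [him]; positivity
  have hB := Literature.NumberTheory.LFunctions.Complex.abs_re_digamma_sub_log_norm_add_re_le hw hy
  rw [him] at hB
  -- the correction term `Re 1/(2w) ≥ 0`
  have hcorr : 0 ≤ (1 / (2 * w)).re := by
    rw [one_div, Complex.inv_re]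
    apply div_nonneg _ (Complex.normSq_nonneg _)
    simp [hre]
  -- so `Re ψ(w) ≤ log ‖w‖ + 4/(3t³) + π/(3t²)`
  have h1 : (Complex.digamma w).re ≤ Real.log ‖w‖ + (4 / (3 * t ^ 3) + π / (3 * t ^ 2)) := by
    have hab := (abs_le.1 hB).2
    have ht2 : |t / 2| = t / 2 := abs_of_pos (by positivity)
    rw [ht2] at hab
    have e1 : 1 / (6 * (t / 2) ^ 3) + π / (12 * (t / 2) ^ 2) = 4 / (3 * t ^ 3) + π / (3 * t ^ 2) := by
      field_simp
      ring
    linarith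
  -- `‖w‖² = 1/16 + t²/4 ≤ (197/784) t²`
  have hnorm : ‖w‖ ^ 2 = 1 / 16 + t ^ 2 / 4 := by
    rw [Complex.sq_norm, Complex.normSq_apply, hre, him]
    ring
  have hwpos : 0 < ‖w‖ := by
    have : 0 < ‖w‖ ^ 2 := by rw [hnorm]; positivity
    nlinarith [norm_nonneg w]
  -- `log ‖w‖ ≤ log t − log 2 + 1/392`
  have hlogw : Real.log ‖w‖ ≤ Real.log t - Real.log 2 + 1 / 392 := by
    have hsq : ‖w‖ ^ 2 ≤ t ^ 2 * (197 / 784) := by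
      rw [hnorm]; nlinarith
    have hlog2 : Real.log (‖w‖ ^ 2) ≤ Real.log (t ^ 2 * (197 / 784)) :=
      Real.log_le_log (by positivity) hsq
    rw [Real.log_pow, Real.log_mul (by positivity) (by norm_num), Real.log_pow] at hlog2
    have h197 : Real.log (197 / 784 : ℝ) = Real.log (197 / 196) - 2 * Real.log 2 := by
      rw [show (197 / 784 : ℝ) = (197 / 196) / 2 ^ 2 by norm_num, Real.log_div (by norm_num) (by norm_num),
        Real.log_pow]
      push_cast
      ring
    have h196 : Real.log (197 / 196 : ℝ) ≤ 197 / 196 - 1 := Real.log_le_sub_one_of_pos (by norm_num)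
    push_cast at hlog2
    linarith
  -- numerics
  have hlog2 : (0.6931471803 : ℝ) < Real.log 2 := Real.log_two_gt_d9
  have hlogpi : 1 < Real.log π := by
    rw [Real.lt_log_iff_exp_lt Real.pi_pos]
    linarith [Real.exp_one_lt_d9, Real.pi_gt_three]
  have ht3 : 4 / (3 * t ^ 3) ≤ 4 / (3 * 7 ^ 3) := by
    apply div_le_div_of_nonneg_left (by norm_num) (by positivity)
    have : (7:ℝ) ^ 3 ≤ t ^ 3 := pow_le_pow_left₀ (by norm_num) ht 3
    linarith
  have ht2 : π / (3 * t ^ 2) ≤ 3.15 / (3 * 7 ^ 2) := by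
    have h72 : (7:ℝ) ^ 2 ≤ t ^ 2 := pow_le_pow_left₀ (by norm_num) ht 2
    calc π / (3 * t ^ 2) ≤ π / (3 * 7 ^ 2) :=
          div_le_div_of_nonneg_left Real.pi_pos.le (by positivity) (by linarith)
      _ ≤ 3.15 / (3 * 7 ^ 2) := by
          apply div_le_div_of_nonneg_right Real.pi_lt_d2.le (by positivity)
  norm_num at ht3 ht2
  linarith


/-! ### Assembly -/

/-- **[Gr26] Lemma 3.1 (the archimedean density), PROVED** — discharge of the claim `lemma_3_1`:
`h₊` is strictly increasing on `(0, ∞)`; for `t > 0`, `h₊′(t) = (t/2) Σ_{k≥0} (k+¼)/((k+¼)² + (t/2)²)²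
≤ 1/t + 13/(10t²)`; `h₊(t) ≤ log t − 8/5` for `t ≥ 7`. [cite: Groskin2026, Lemma 3.1 (p. 9)] -/
theorem lemma_3_1_holds : lemma_3_1 :=
  ⟨hPlus_strictMonoOn, fun t ht ↦ ⟨hasDerivAt_hPlus t, deriv_hPlus_le ht⟩,
    fun _ ht ↦ hPlus_le_log_sub ht⟩

end Groskin2026

end Literature.NumberTheory.LFunctions

end
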